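import Literature.Computability.AlgebraicComplexity.BirkhoffShadow

/-!
# Shadow complexity of the Birkhoff polytope — proof of the upper bound (HY21 Prop. 23)

Topic `Literature/Computability/AlgebraicComplexity`; companion proof file of
`BirkhoffShadow.lean`, discharging the named fact
`Literature.Computability.AlgebraicComplexity.HrubesYehudayoff2021_prop23_upper`
(`σ(DS_n) ≤ 2^{O(n)}`) as `HrubesYehudayoff2021_prop23_upper_holds`, with the explicit constants
`C = 6`, `n₀ = 1` (`|vert L(DS_n)| ≤ 4·16^n ≤ 2^{6n}` for `n ≥ 1`).

Source: P. Hrubeš, A. Yehudayoff, *Shadows of Newton polytopes*, 36th Computational Complexity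
Conference (CCC 2021), LIPIcs 200, 9:1–9:23, doi:10.4230/LIPIcs.CCC.2021.9 — Proposition 23
(pp. 9:10–9:11) and its printed proof ("`σ(DS_{2n}) ≤ 2·C(2n,n)·σ(DS_n)` … By induction, this
indeed implies `σ(DS_n) ≤ 2^{O(n)}`"), Remark 24.

## References

* P. Hrubeš, A. Yehudayoff, *Shadows of Newton polytopes*, CCC 2021, LIPIcs 200:9, Prop. 23 and
  its proof, Remark 24 [HrubesYehudayoff2021].
-/

noncomputable section

namespace Literature.Computability.AlgebraicComplexity

/-!
## Proof of the upper half of Proposition 23 (HY21 §5, proof of Prop. 23)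

We follow the printed proof [cite: HrubesYehudayoff2021, Prop. 23, p. 9:11]: "we claim that
`σ(DS_{2n}) ≤ 2·C(2n,n)·σ(DS_n)`": for `S ⊆ [2n]` of size `n`, the `2n × 2n` permutation matrices
mapping the first `n` columns onto the rows `S` form a set `V_S` with `conv(V_S) ≅ DS_n × DS_n`,
whose shadow is a Minkowski sum of two shadows of `DS_n` and hence has at most `2σ(DS_n)`
vertices, and `DS_{2n} = conv ⋃_S conv(V_S)`; "By induction, this indeed implies
`σ(DS_n) ≤ 2^{O(n)}`."  We run the same recursion with a `⌊m/2⌋ + ⌈m/2⌉` column split (so no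
monotonicity in `n` is needed) and the explicit constants `|vert L(DS_n)| ≤ 4·16^n ≤ 2^{6n}`
(`n ≥ 1`).

The only planar ingredient — "a Minkowski sum of two polygons with `k₁`, `k₂` vertices has at most
`k₁ + k₂` vertices" — is rendered through *uniquely supported points*: for additive `c d : G →+ ℝ`
the points of `X` that are the unique maximiser over `X` of a functional of the pencil `c + t•d`.
Four pencils (`±x₀ + t x₁`, `±x₁ + t x₀`) cover every nonzero direction of `ℝ²`, and every extreme
point of `conv S` (`S` finite) is the unique maximiser over `S` of some functional (Hahn–Banach
separation from `conv (S ∖ {p})`).  For one pencil the Minkowski bound is an interval-counting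
lemma on `ℝ` (two families of pairwise disjoint order-connected sets have at most `k₁ + k₂`
meeting pairs).
-/

namespace HrubesYehudayoff2021Prop23

open scoped Pointwise

/-! ### An interval-counting lemma on `ℝ` -/

/-- Two families of pairwise disjoint order-connected subsets of `ℝ`, indexed by finite sets `A`
and `B`, have at most `#A' + #B'` meeting pairs, where `A'`, `B'` index the nonempty members
(injection: send a meeting pair to whichever member's right end comes first). [folklore] -/
theorem ncard_meeting_pairs_le {α β : Type*} (A : Set α) (B : Set β) (hA : A.Finite)
    (hB : B.Finite) (I : α → Set ℝ) (J : β → Set ℝ)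
    (hI : ∀ a ∈ A, (I a).OrdConnected) (hJ : ∀ b ∈ B, (J b).OrdConnected)
    (hdI : ∀ a ∈ A, ∀ a' ∈ A, ∀ t, t ∈ I a → t ∈ I a' → a = a')
    (hdJ : ∀ b ∈ B, ∀ b' ∈ B, ∀ t, t ∈ J b → t ∈ J b' → b = b') :
    {ab : α × β | ab.1 ∈ A ∧ ab.2 ∈ B ∧ (I ab.1 ∩ J ab.2).Nonempty}.ncard ≤
      {a | a ∈ A ∧ (I a).Nonempty}.ncard + {b | b ∈ B ∧ (J b).Nonempty}.ncard := by
  classical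
  calc {ab : α × β | ab.1 ∈ A ∧ ab.2 ∈ B ∧ (I ab.1 ∩ J ab.2).Nonempty}.ncard
      ≤ (Sum.inl '' {a | a ∈ A ∧ (I a).Nonempty} ∪
          Sum.inr '' {b | b ∈ B ∧ (J b).Nonempty}).ncard := by
        refine Set.ncard_le_ncard_of_injOn
          (fun ab : α × β =>
            if ∀ t ∈ I ab.1, ∃ t' ∈ J ab.2, t ≤ t' then Sum.inl ab.1 else Sum.inr ab.2)
          ?_ ?_ ?_
        · rintro ⟨a, b⟩ ⟨ha, hb, t, hta, htb⟩
          dsimp only at ha hb hta htb ⊢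
          by_cases h : ∀ t ∈ I a, ∃ t' ∈ J b, t ≤ t'
          · rw [if_pos h]
            exact Or.inl ⟨a, ⟨ha, t, hta⟩, rfl⟩
          · rw [if_neg h]
            exact Or.inr ⟨b, ⟨hb, t, htb⟩, rfl⟩
        · rintro ⟨a, b⟩ ⟨ha, hb, t₁, h₁a, h₁b⟩ ⟨a', b'⟩ ⟨ha', hb', t₂, h₂a, h₂b⟩ heq
          dsimp only at ha hb h₁a h₁b ha' hb' h₂a h₂b heq
          by_cases h : ∀ t ∈ I a, ∃ t' ∈ J b, t ≤ t'
          · rw [if_pos h] at heq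
            by_cases h' : ∀ t ∈ I a', ∃ t' ∈ J b', t ≤ t'
            · rw [if_pos h', Sum.inl.injEq] at heq
              subst heq
              have hbb : b = b' := by
                rcases le_total t₁ t₂ with h12 | h12
                · obtain ⟨t', ht', h2t'⟩ := h t₂ h₂a
                  exact hdJ b hb b' hb' t₂ ((hJ b hb).out h₁b ht' ⟨h12, h2t'⟩) h₂b
                · obtain ⟨t', ht', h1t'⟩ := h' t₁ h₁a
                  exact hdJ b hb b' hb' t₁ h₁b ((hJ b' hb').out h₂b ht' ⟨h12, h1t'⟩)
              rw [hbb]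
            · rw [if_neg h'] at heq
              exact absurd heq Sum.inl_ne_inr
          · rw [if_neg h] at heq
            by_cases h' : ∀ t ∈ I a', ∃ t' ∈ J b', t ≤ t'
            · rw [if_pos h'] at heq
              exact absurd heq Sum.inr_ne_inl
            · rw [if_neg h', Sum.inr.injEq] at heq
              subst heq
              obtain ⟨t₀, ht₀, h0⟩ : ∃ t₀ ∈ I a, ∀ t' ∈ J b, t' < t₀ := by
                by_contra hc
                refine h fun t ht => ?_
                by_contra hc'
                exact hc ⟨t, ht, fun t' ht' => lt_of_not_ge fun hle => hc' ⟨t', ht', hle⟩⟩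
              obtain ⟨s₀, hs₀, hs0⟩ : ∃ s₀ ∈ I a', ∀ t' ∈ J b, t' < s₀ := by
                by_contra hc
                refine h' fun t ht => ?_
                by_contra hc'
                exact hc ⟨t, ht, fun t' ht' => lt_of_not_ge fun hle => hc' ⟨t', ht', hle⟩⟩
              have haa : a = a' := by
                rcases le_total t₁ t₂ with h12 | h12
                · exact hdI a ha a' ha' t₂ ((hI a ha).out h₁a ht₀ ⟨h12, (h0 t₂ h₂b).le⟩) h₂a
                · exact hdI a ha a' ha' t₁ h₁a
                    ((hI a' ha').out h₂a hs₀ ⟨h12, (hs0 t₁ h₁b).le⟩)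
              rw [haa]
        · exact ((hA.subset fun a ha => ha.1).image _).union
            ((hB.subset fun b hb => hb.1).image _)
    _ ≤ (Sum.inl '' {a | a ∈ A ∧ (I a).Nonempty}).ncard +
          (Sum.inr '' {b | b ∈ B ∧ (J b).Nonempty}).ncard := Set.ncard_union_le _ _
    _ = _ := by
        rw [Set.ncard_image_of_injective _ Sum.inl_injective,
          Set.ncard_image_of_injective _ Sum.inr_injective]

/-! ### Uniquely supported points of a pencil of functionals -/

section Pencil

variable {G : Type*} [AddCommGroup G] (c d : G →+ ℝ)

/-- `UM[c, d, X]`: the points `p ∈ X` that are the unique maximiser over `X` of `c + t • d` for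
some real `t` (notation local to this file). -/
local notation3 (prettyPrint := false) "UM[" c ", " d ", " X "]" =>
  {p | p ∈ X ∧ ∃ t : ℝ, ∀ q ∈ X, q ≠ p → c q + t * d q < c p + t * d p}

/-- Uniquely supported points of `X` lie in `X`. [folklore] -/
theorem um_subset (X : Set G) : UM[c, d, X] ⊆ X := fun _ hp => hp.1

/-- A point uniquely supported in a union is uniquely supported in the member containing it
(HY21: "the vertices of `conv ⋃_S conv(V_S)` are vertices of some `conv(V_S)`"). [folklore] -/
theorem um_iUnion_subset {ι : Type*} (X : ι → Set G) :
    UM[c, d, ⋃ i, X i] ⊆ ⋃ i, UM[c, d, X i] := by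
  rintro p ⟨hp, t, ht⟩
  obtain ⟨i, hi⟩ := Set.mem_iUnion.1 hp
  exact Set.mem_iUnion.2 ⟨i, hi, t, fun q hq hne => ht q (Set.mem_iUnion.2 ⟨i, hq⟩) hne⟩

/-- Subadditivity of the number of uniquely supported points over finite unions. [folklore] -/
theorem ncard_um_iUnion_le {ι : Type*} [Fintype ι] (X : ι → Set G) (hX : ∀ i, (X i).Finite) :
    (UM[c, d, ⋃ i, X i]).ncard ≤ ∑ i, (UM[c, d, X i]).ncard :=
  (Set.ncard_le_ncard (um_iUnion_subset c d X)
    (Set.finite_iUnion fun i => (hX i).subset (um_subset c d (X i)))).trans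
    (Set.ncard_iUnion_le_of_fintype _)

/-- The set of pencil parameters `t` for which `p` is the unique maximiser over `X` is
order-connected … [folklore] -/
theorem ordConnected_params (X : Set G) (p : G) :
    Set.OrdConnected {t : ℝ | ∀ q ∈ X, q ≠ p → c q + t * d q < c p + t * d p} := by
  refine ⟨fun t₁ ht₁ t₂ ht₂ t ht q hq hqp => ?_⟩
  have h1 := ht₁ q hq hqp
  have h2 := ht₂ q hq hqp
  have ht1 : t₁ ≤ t := ht.1
  have ht2 : t ≤ t₂ := ht.2
  rcases le_total (d q) (d p) with h | h
  · nlinarith [mul_le_mul_of_nonneg_left h (sub_nonneg.2 ht1)]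
  · nlinarith [mul_le_mul_of_nonneg_left h (sub_nonneg.2 ht2)]

/-- … and two distinct points of `X` are never unique maximisers for the same parameter.
[folklore] -/
theorem params_disjoint (X : Set G) {p p' : G} (hp : p ∈ X) (hp' : p' ∈ X) (t : ℝ)
    (ht : ∀ q ∈ X, q ≠ p → c q + t * d q < c p + t * d p)
    (ht' : ∀ q ∈ X, q ≠ p' → c q + t * d q < c p' + t * d p') : p = p' := by
  by_contra h
  exact lt_asymm (ht p' hp' (Ne.symm h)) (ht' p hp h)

/-- **Minkowski step** (the planar ingredient of HY21 Prop. 23: the shadow of `P × Q` is the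
Minkowski sum of the shadows and has at most `k₁ + k₂` vertices), pencil form.
[cite: HrubesYehudayoff2021, Prop. 23 (proof)] -/
theorem ncard_um_add_le (A B : Set G) (hA : A.Finite) (hB : B.Finite) :
    (UM[c, d, A + B]).ncard ≤ (UM[c, d, A]).ncard + (UM[c, d, B]).ncard := by
  have hsub : UM[c, d, A + B] ⊆ (fun ab : G × G => ab.1 + ab.2) ''
      {ab : G × G | ab.1 ∈ A ∧ ab.2 ∈ B ∧
        ({t : ℝ | ∀ q ∈ A, q ≠ ab.1 → c q + t * d q < c ab.1 + t * d ab.1} ∩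
          {t : ℝ | ∀ q ∈ B, q ≠ ab.2 → c q + t * d q < c ab.2 + t * d ab.2}).Nonempty} := by
    rintro p ⟨hp, t, ht⟩
    obtain ⟨a, ha, b, hb, rfl⟩ := Set.mem_add.1 hp
    refine ⟨(a, b), ⟨ha, hb, t, ?_, ?_⟩, rfl⟩
    · intro a' ha' hne
      have h := ht (a' + b) (Set.add_mem_add ha' hb) (by simpa using hne)
      simp only [map_add, mul_add] at h
      linarith
    · intro b' hb' hne
      have h := ht (a + b') (Set.add_mem_add ha hb') (by simpa using hne)
      simp only [map_add, mul_add] at h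
      linarith
  have hPfin : {ab : G × G | ab.1 ∈ A ∧ ab.2 ∈ B ∧
      ({t : ℝ | ∀ q ∈ A, q ≠ ab.1 → c q + t * d q < c ab.1 + t * d ab.1} ∩
        {t : ℝ | ∀ q ∈ B, q ≠ ab.2 → c q + t * d q < c ab.2 + t * d ab.2}).Nonempty}.Finite :=
    (hA.prod hB).subset fun ab hab => ⟨hab.1, hab.2.1⟩
  refine (Set.ncard_le_ncard hsub (hPfin.image _)).trans ((Set.ncard_image_le hPfin).trans ?_)
  exact ncard_meeting_pairs_le A B hA hB _ _ (fun a _ => ordConnected_params c d A a)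
    (fun b _ => ordConnected_params c d B b)
    (fun a ha a' ha' t ht ht' => params_disjoint c d A ha ha' t ht ht')
    (fun b hb b' hb' t ht ht' => params_disjoint c d B hb hb' t ht ht')

/-! ### The halving recursion on permutation sums (HY21, proof of Prop. 23) -/

universe u

variable {R C : Type u} [Fintype R] [Fintype C] [DecidableEq R] [DecidableEq C]

/-- Splitting a sum over `C` at a finset `C₁` (stated for the two subtypes with the `Fintype`
arguments exactly as elaboration synthesises them at the use sites below). [folklore] -/
theorem sum_mem_add_sum_not_mem (C₁ : Finset C) (f : C → G) :
    ∑ x : {x // x ∈ C₁}, f x + ∑ x : {x // x ∉ C₁}, f x = ∑ x, f x := by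
  rw [← Finset.sum_subtype C₁ (fun _ => Iff.rfl) f,
    ← Finset.sum_subtype C₁ᶜ (fun _ => Finset.mem_compl) f, Finset.sum_add_sum_compl]

omit [Fintype R] in
/-- `V = ⋃_S V_S`: splitting the columns at `C₁`, a bijection `e : C ≃ R` is a pair of bijections
`C₁ ≃ S`, `C₁ᶜ ≃ Sᶜ` with `S = e(C₁)`, and the permutation sum splits accordingly (HY21:
"`conv(V_S)` is a product of two Birkhoff polytopes").
[cite: HrubesYehudayoff2021, Prop. 23 (proof)] -/
theorem permSums_eq_iUnion (w : R → C → G) (C₁ : Finset C) :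
    Set.range (fun e : C ≃ R => ∑ x, w (e x) x) =
      ⋃ S : Finset R,
        (Set.range (fun e : {x // x ∈ C₁} ≃ {r // r ∈ S} => ∑ x, w (e x) x) +
          Set.range (fun e : {x // x ∉ C₁} ≃ {r // r ∉ S} => ∑ x, w (e x) x)) := by
  ext p
  simp only [Set.mem_range, Set.mem_iUnion, Set.mem_add]
  constructor
  · rintro ⟨e, rfl⟩
    refine ⟨C₁.map e.toEmbedding, _,
      ⟨e.subtypeEquiv fun x => (Finset.mem_map' e.toEmbedding).symm, rfl⟩, _,
      ⟨e.subtypeEquiv fun x => (Finset.mem_map' e.toEmbedding).not.symm, rfl⟩, ?_⟩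
    exact sum_mem_add_sum_not_mem C₁ (fun x => w (e x) x)
  · rintro ⟨S, _, ⟨e₁, rfl⟩, _, ⟨e₂, rfl⟩, rfl⟩
    refine ⟨(Equiv.sumCompl fun x => x ∈ C₁).symm.trans
      ((e₁.sumCongr e₂).trans (Equiv.sumCompl fun r => r ∈ S)), ?_⟩
    rw [← sum_mem_add_sum_not_mem C₁ (fun x =>
      w (((Equiv.sumCompl fun x => x ∈ C₁).symm.trans
        ((e₁.sumCongr e₂).trans (Equiv.sumCompl fun r => r ∈ S))) x) x)]
    congr 1
    · exact Finset.sum_congr rfl fun x _ => by simp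
    · exact Finset.sum_congr rfl fun x _ => by simp

/-- One step of the recursion: `f(V) ≤ 2^{#R} · (B₁ + B₂)` if the two families of half-size
permutation sums are bounded by `B₁`, `B₂` (HY21: `σ(DS_{2n}) ≤ C(2n,n) · 2σ(DS_n)`).
[cite: HrubesYehudayoff2021, Prop. 23 (proof)] -/
theorem ncard_um_permSums_step (w : R → C → G) (C₁ : Finset C) (B₁ B₂ : ℕ)
    (h₁ : ∀ S : Finset R,
      (UM[c, d, Set.range (fun e : {x // x ∈ C₁} ≃ {r // r ∈ S} => ∑ x, w (e x) x)]).ncard ≤ B₁)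
    (h₂ : ∀ S : Finset R,
      (UM[c, d, Set.range (fun e : {x // x ∉ C₁} ≃ {r // r ∉ S} => ∑ x, w (e x) x)]).ncard ≤ B₂) :
    (UM[c, d, Set.range (fun e : C ≃ R => ∑ x, w (e x) x)]).ncard ≤
      2 ^ Fintype.card R * (B₁ + B₂) := by
  rw [permSums_eq_iUnion w C₁]
  refine (ncard_um_iUnion_le c d _ fun S => (Set.finite_range _).add (Set.finite_range _)).trans ?_
  refine (Finset.sum_le_sum fun S _ => (ncard_um_add_le c d _ _ (Set.finite_range _)
    (Set.finite_range _)).trans (add_le_add (h₁ S) (h₂ S))).trans ?_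
  rw [Finset.sum_const, Finset.card_univ, Fintype.card_finset, smul_eq_mul]

/-- **HY21 Prop. 23, upper half, counting form**: for every pencil, the permutation sums
`{∑_x w (e x) x : e : C ≃ R}` have at most `16^{#C}` uniquely supported points
(recursion `f(m) ≤ 2^m (f ⌊m/2⌋ + f ⌈m/2⌉)`, `f(0), f(1) ≤ 1`).
[cite: HrubesYehudayoff2021, Prop. 23 (proof)] -/
theorem ncard_um_permSums_le (m : ℕ) :
    ∀ (R C : Type u) [Fintype R] [Fintype C] [DecidableEq R] [DecidableEq C],
      Fintype.card C = m → ∀ w : R → C → G,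
        (UM[c, d, Set.range (fun e : C ≃ R => ∑ x, w (e x) x)]).ncard ≤ 2 ^ (4 * m) := by
  induction m using Nat.strong_induction_on with
  | _ m ih =>
  intro R C _ _ _ _ hCm w
  rcases ne_or_eq (Fintype.card R) (Fintype.card C) with hRC | hRC
  · have hempty : Set.range (fun e : C ≃ R => ∑ x, w (e x) x) = ∅ :=
      Set.range_eq_empty_iff.2 ⟨fun e => hRC (Fintype.card_congr e).symm⟩
    rw [hempty]
    simp
  have hfin : (Set.range (fun e : C ≃ R => ∑ x, w (e x) x)).Finite := Set.finite_range _
  rcases Nat.lt_or_ge 1 m with hm | hm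
  swap
  · have hsub : (Set.range (fun e : C ≃ R => ∑ x, w (e x) x)).Subsingleton := by
      rintro _ ⟨e, rfl⟩ _ ⟨e', rfl⟩
      have : Subsingleton R := Fintype.card_le_one_iff_subsingleton.1 (by omega)
      obtain rfl := Subsingleton.elim e e'
      rfl
    exact ((Set.ncard_le_one (hfin.subset fun p hp => hp.1)).2
      fun a ha b hb => hsub ha.1 hb.1).trans Nat.one_le_two_pow
  obtain ⟨C₁, -, hC₁⟩ := Finset.exists_subset_card_eq (s := (Finset.univ : Finset C))
    (n := m / 2) (by rw [Finset.card_univ, hCm]; omega)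
  have hc1 : Fintype.card {x // x ∈ C₁} = m / 2 := by rw [Fintype.card_coe, hC₁]
  have hc2 : Fintype.card {x // x ∉ C₁} = m - m / 2 := by
    rw [Fintype.card_subtype_compl, Fintype.card_coe, hC₁, hCm]
  refine (ncard_um_permSums_step c d w C₁ (2 ^ (4 * (m / 2))) (2 ^ (4 * (m - m / 2)))
    (fun S => ih (m / 2) (by omega) {r // r ∈ S} {x // x ∈ C₁} hc1 fun r x => w r x)
    (fun S => ih (m - m / 2) (by omega) {r // r ∉ S} {x // x ∉ C₁} hc2 fun r x => w r x)).trans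
    ?_
  rw [hRC, hCm]
  have h1 : 2 ^ (4 * (m / 2)) ≤ 2 ^ (4 * (m - m / 2)) :=
    Nat.pow_le_pow_right (by norm_num) (by omega)
  have h2 : m + 1 + 4 * (m - m / 2) ≤ 4 * m := by omega
  calc 2 ^ m * (2 ^ (4 * (m / 2)) + 2 ^ (4 * (m - m / 2)))
      ≤ 2 ^ m * (2 * 2 ^ (4 * (m - m / 2))) := Nat.mul_le_mul_left _ (by omega)
    _ = 2 ^ (m + 1 + 4 * (m - m / 2)) := by rw [pow_add, pow_succ]; ring
    _ ≤ 2 ^ (4 * m) := Nat.pow_le_pow_right (by norm_num) h2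

end Pencil

/-! ### The plane: extreme points are uniquely supported by one of four pencils -/

section Plane

local notation3 (prettyPrint := false) "UM[" c ", " d ", " X "]" =>
  {p | p ∈ X ∧ ∃ t : ℝ, ∀ q ∈ X, q ≠ p → c q + t * d q < c p + t * d p}

/-- Every vertex (extreme point) of `conv S`, `S ⊆ ℝ²` finite, is the unique maximiser over `S` of
a linear functional (strict separation of `p` from `conv (S ∖ {p})`), hence uniquely supported by
one of the four pencils `x₀ + t x₁`, `−x₀ + t x₁`, `x₁ + t x₀`, `−x₁ + t x₀`. [folklore] -/
theorem extremePoints_subset_um4 (c₀ c₁ : (Fin 2 → ℝ) →+ ℝ) (hc₀ : ∀ x, c₀ x = x 0)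
    (hc₁ : ∀ x, c₁ x = x 1) (S : Set (Fin 2 → ℝ)) (hS : S.Finite) :
    (convexHull ℝ S).extremePoints ℝ ⊆
      UM[c₀, c₁, S] ∪ UM[(-c₀), c₁, S] ∪ UM[c₁, c₀, S] ∪ UM[(-c₁), c₀, S] := by
  intro p hp
  have hpS : p ∈ S := extremePoints_convexHull_subset hp
  have hnot : p ∉ convexHull ℝ (S \ {p}) := by
    have h := ((convex_convexHull ℝ S).mem_extremePoints_iff_mem_sdiff_convexHull_sdiff).1 hp
    have hsub : S \ {p} ⊆ convexHull ℝ S \ {p} := fun x hx => ⟨subset_convexHull ℝ S hx.1, hx.2⟩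
    exact fun h' => h.2 (convexHull_mono hsub h')
  obtain ⟨f, u, hfu, hf⟩ := geometric_hahn_banach_point_closed (convex_convexHull ℝ _)
    (Set.Finite.isCompact_convexHull ℝ (hS.subset fun x hx => hx.1)).isClosed hnot
  obtain ⟨w0, w1, hf2⟩ : ∃ w0 w1 : ℝ, ∀ x : Fin 2 → ℝ, f x = x 0 * w0 + x 1 * w1 := by
    refine ⟨f (Pi.single 0 1), f (Pi.single 1 1), fun x => ?_⟩
    have hx : x = x 0 • (Pi.single 0 1 : Fin 2 → ℝ) + x 1 • (Pi.single 1 1 : Fin 2 → ℝ) := by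
      ext i
      fin_cases i <;> simp
    conv_lhs => rw [hx]
    simp only [map_add, map_smul, smul_eq_mul]
  have hsep : ∀ q ∈ S, q ≠ p → p 0 * w0 + p 1 * w1 < q 0 * w0 + q 1 * w1 := by
    intro q hq hne
    have h := hfu.trans (hf q (subset_convexHull ℝ _ ⟨hq, hne⟩))
    rwa [hf2 p, hf2 q] at h
  simp only [Set.mem_union, Set.mem_setOf_eq, hc₀, hc₁, AddMonoidHom.neg_apply]
  rcases lt_trichotomy w0 0 with h0 | h0 | h0
  · -- `w0 < 0`: pencil `x₀ + t x₁` with `t = w1 / w0`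
    refine Or.inl (Or.inl (Or.inl ⟨hpS, w1 / w0, fun q hq hne => ?_⟩))
    have h := hsep q hq hne
    have hw1 : w1 / w0 * w0 = w1 := div_mul_cancel₀ w1 h0.ne
    have e1 : w0 * (p 0 + w1 / w0 * p 1) = p 0 * w0 + p 1 * w1 := by
      linear_combination p 1 * hw1
    have e2 : w0 * (q 0 + w1 / w0 * q 1) = q 0 * w0 + q 1 * w1 := by
      linear_combination q 1 * hw1
    have h' : w0 * (p 0 + w1 / w0 * p 1) < w0 * (q 0 + w1 / w0 * q 1) := by rw [e1, e2]; exact h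
    exact lt_of_mul_lt_mul_of_nonpos_left h' h0.le
  · -- `w0 = 0`
    subst h0
    rcases lt_trichotomy w1 0 with h1 | h1 | h1
    · -- pencil `x₁ + t x₀`, `t = 0`
      refine Or.inl (Or.inr ⟨hpS, 0, fun q hq hne => ?_⟩)
      have h := hsep q hq hne
      simp only [mul_zero, zero_add] at h
      have := lt_of_mul_lt_mul_of_nonpos_right h h1.le
      linarith
    · -- `f = 0`: then `S = {p}` and any pencil works vacuously
      subst h1
      refine Or.inl (Or.inl (Or.inl ⟨hpS, 0, fun q hq hne => ?_⟩))
      have h := hsep q hq hne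
      simp at h
    · -- pencil `−x₁ + t x₀`, `t = 0`
      refine Or.inr ⟨hpS, 0, fun q hq hne => ?_⟩
      have h := hsep q hq hne
      simp only [mul_zero, zero_add] at h
      have := lt_of_mul_lt_mul_right h h1.le
      linarith
  · -- `w0 > 0`: pencil `−x₀ + t x₁` with `t = -(w1 / w0)`
    refine Or.inl (Or.inl (Or.inr ⟨hpS, -(w1 / w0), fun q hq hne => ?_⟩))
    have h := hsep q hq hne
    have hw1 : w1 / w0 * w0 = w1 := div_mul_cancel₀ w1 h0.ne'
    have e1 : w0 * (-p 0 + -(w1 / w0) * p 1) = -(p 0 * w0 + p 1 * w1) := by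
      linear_combination (-p 1) * hw1
    have e2 : w0 * (-q 0 + -(w1 / w0) * q 1) = -(q 0 * w0 + q 1 * w1) := by
      linear_combination (-q 1) * hw1
    have h' : w0 * (-q 0 + -(w1 / w0) * q 1) < w0 * (-p 0 + -(w1 / w0) * p 1) := by
      rw [e1, e2]; exact neg_lt_neg h
    exact lt_of_mul_lt_mul_left h' h0.le

/-- The projected permutation matrices are permutation sums: `L(P_ρ) = ∑_j L(E_{ρ j, j})`.
[folklore] -/
theorem image_permMatrixPoints_eq_range {n : ℕ} (L : (Fin n × Fin n → ℝ) →ₗ[ℝ] (Fin 2 → ℝ)) :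
    L '' permMatrixPoints n =
      Set.range (fun e : Fin n ≃ Fin n => ∑ x, (fun i j => L (Pi.single (i, j) 1)) (e x) x) := by
  have hx : ∀ ρ : Equiv.Perm (Fin n),
      (fun ij : Fin n × Fin n => if ρ ij.2 = ij.1 then (1 : ℝ) else 0) =
        ∑ j, Pi.single (ρ j, j) (1 : ℝ) := by
    intro ρ
    ext ⟨i, j₀⟩
    rw [Finset.sum_apply, Finset.sum_eq_single j₀]
    · by_cases h : ρ j₀ = i
      · simp [h]
      · simp [h, Ne.symm h]
    · intro j _ hj
      simp [hj.symm]
    · simp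
  have hL : ∀ ρ : Equiv.Perm (Fin n),
      L (fun ij : Fin n × Fin n => if ρ ij.2 = ij.1 then (1 : ℝ) else 0) =
        ∑ x, (fun i j => L (Pi.single (i, j) 1)) (ρ x) x := by
    intro ρ
    rw [hx, map_sum]
  ext p
  simp only [permMatrixPoints, Set.mem_image, Set.mem_setOf_eq, Set.mem_range]
  constructor
  · rintro ⟨_, ⟨ρ, rfl⟩, rfl⟩
    exact ⟨ρ, (hL ρ).symm⟩
  · rintro ⟨ρ, rfl⟩
    exact ⟨_, ⟨ρ, rfl⟩, hL ρ⟩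

/-- Counting form of the upper bound: `|vert L(DS_n)| ≤ 4 · 16^n` for every `n` and `L`.
[cite: HrubesYehudayoff2021, Prop. 23 and Remark 24] -/
theorem birkhoffShadowVertexCount_le {n : ℕ} (L : (Fin n × Fin n → ℝ) →ₗ[ℝ] (Fin 2 → ℝ)) :
    birkhoffShadowVertexCount L ≤ 4 * 2 ^ (4 * n) := by
  have hS := image_permMatrixPoints_eq_range L
  have hfin : (L '' permMatrixPoints n).Finite := by rw [hS]; exact Set.finite_range _
  have hb : ∀ c d : (Fin 2 → ℝ) →+ ℝ, (UM[c, d, L '' permMatrixPoints n]).ncard ≤ 2 ^ (4 * n) := by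
    intro c d
    rw [hS]
    exact ncard_um_permSums_le c d n (Fin n) (Fin n) (Fintype.card_fin n)
      (fun i j => L (Pi.single (i, j) 1))
  have hf : ∀ c d : (Fin 2 → ℝ) →+ ℝ, (UM[c, d, L '' permMatrixPoints n]).Finite :=
    fun c d => hfin.subset fun p hp => hp.1
  show (Set.extremePoints ℝ (convexHull ℝ (L '' permMatrixPoints n))).ncard ≤ 4 * 2 ^ (4 * n)
  refine (Set.ncard_le_ncard (extremePoints_subset_um4 (Pi.evalAddMonoidHom (fun _ => ℝ) 0)
    (Pi.evalAddMonoidHom (fun _ => ℝ) 1) (fun _ => rfl) (fun _ => rfl) _ hfin)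
    ((((hf _ _).union (hf _ _)).union (hf _ _)).union (hf _ _))).trans ?_
  refine (Set.ncard_union_le _ _).trans ((add_le_add ((Set.ncard_union_le _ _).trans (add_le_add
    ((Set.ncard_union_le _ _).trans (add_le_add (hb _ _) (hb _ _))) (hb _ _))) (hb _ _)).trans ?_)
  omega

end Plane

end HrubesYehudayoff2021Prop23

/-- **Hrubeš–Yehudayoff 2021, Proposition 23, upper half** (`σ(DS_n) ≤ 2^{O(n)}`), discharged with
the explicit constants `C = 6`, `n₀ = 1`: for every `n ≥ 1` and every linear `L : ℝ^{n×n} → ℝ²`,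
`|vert L(DS_n)| ≤ 4·16^n ≤ 2^{6n}`.  Proof = the printed halving recursion
`σ(DS_{2n}) ≤ 2·C(2n,n)·σ(DS_n)` [cite: HrubesYehudayoff2021, Prop. 23 (proof), Remark 24],
see `HrubesYehudayoff2021Prop23.ncard_um_permSums_le`. -/
theorem HrubesYehudayoff2021_prop23_upper_holds : HrubesYehudayoff2021_prop23_upper := by
  refine ⟨6, 1, fun n hn L => ?_⟩
  have h1 := HrubesYehudayoff2021Prop23.birkhoffShadowVertexCount_le L
  have h2 : 4 * 2 ^ (4 * n) ≤ 2 ^ (6 * n) :=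
    calc 4 * 2 ^ (4 * n) = 2 ^ (4 * n + 2) := by rw [pow_add]; ring
      _ ≤ 2 ^ (6 * n) := Nat.pow_le_pow_right (by norm_num) (by omega)
  have h3 : (2 : ℝ) ^ ((6 : ℝ) * n) = (2 : ℝ) ^ (6 * n) := by
    have h6 : ((6 : ℝ) * n) = ((6 * n : ℕ) : ℝ) := by norm_num
    rw [h6, Real.rpow_natCast]
  rw [h3]
  exact_mod_cast h1.trans h2

end Literature.Computability.AlgebraicComplexity

end
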